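import Literature.Geometry.Lorentzian.KerrStationaryBlackHole
import Literature.Geometry.Lorentzian.KerrSchildCoord
import HarnessLib

/-!
# Route ZeroEnergyKerrOrBomb · crux `StationaryLimitReduction` (stmt-FinalStateConjecture-10021), line
# `symplectic-dual-of-the-bomb` — bookkeeping of `T`-EQUIVARIANT chart maps `Θ (x + s e₀) = Θ x + (c s) e₀`

Helper file (`--supports stmt-FinalStateConjecture-10021`) from the lead's wave-1 stub-worker for
`stub_kerrIsometryRigidity` (lead prover-line-stmt-FinalStateConjecture-10021-1, 2026-08-16). The
conclusion `IsKerrCharted 𝓑 A` of that stub and the hypothesis of its neighbour `stub_chartTransfer`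
quantify over a map `Θ : E4 → E4` of a time-translation invariant region `S ⊆ E4` (a Kerr–Schild
region `Kerr.region a r₀`) which intertwines the Kerr–Schild time translation with the adapted
chart's, `Θ (x + s e₀) = Θ x + (c s) e₀` (`c ≠ 0`). This file records the elementary structure of
such maps, used on both sides:

* `apply_eq_apply_foot_add` — normal form `Θ (t, y) = Θ (0, y) + (c t) e₀`: `Θ` is determined by its
  restriction to the slice `{x⁰ = 0}` (so `Θ` on the slab `{x⁰ = τ}` is the time translate of `Θ` on
  `{x⁰ = 0}`, the mechanism of the chart transfer);
* `spatial_apply_eq`, `time_apply_eq` — the spatial part of `Θ` is time independent, the time part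
  is `f(y) + c t`;
* `add_smul_mem_image` — the image `Θ '' S` is time-translation invariant;
* `injOn_iff_injOn_spatial` — `Θ` is injective on `S` iff the SPATIAL part `y ↦ (Θ (0, y))_{space}`
  is injective on the slice `{y | (0, y) ∈ S}` (the time parts can always be matched since `c ≠ 0`);
* `fderiv_apply_basisVector_zero` — `dΘ_x (e₀) = c e₀` wherever `Θ` is differentiable (so that,
  composed with an adapted chart `A`, `dA (e₀) = T`, the push-forward of `∂_{t*}` is `c T`);
* `Kerr.region` is time-translation invariant in the form these lemmas consume
  (`kerrRegion_add_smul_mem`, from the tree's `Kerr.add_smul_basisVector_zero_mem_region`).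

Elementary linear algebra on `E4 = ℝ × E3`; no named fact, nothing restated. References:
Alexakis–Ionescu–Klainerman arXiv:0904.0982, §1.1 (adapted coordinates `T = ∂₀`); Dafermos–Rodnianski
arXiv:0811.0354, §5.1 (`∂_{t*}` and the slices `{t* = c}` of the Kerr–Schild chart).
-/

set_option linter.dupNamespace false

noncomputable section

open scoped Manifold ContDiff Topology
open Set Filter

namespace Summit.FinalStateConjecture.FinalStateConjecture.Theorems.SymplecticDualOfTheBomb

open Literature.Geometry.Lorentzian

/-! ## §E1 Coordinates on `E4`: time, space, the time axis `e₀` -/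

/-- `x = (0, y) + t e₀` with `t = x⁰`, `y` the spatial part of `x` (Dafermos–Rodnianski
arXiv:0811.0354, §5.1). [folklore] -/
theorem ofTimeSpace_zero_spatial_add_time_smul (x : E4) :
    E4.ofTimeSpace 0 (E4.spatial x) + E4.time x • E4.basisVector 0 = x := by
  rw [E4.ofTimeSpace_zero_add_smul, E4.ofTimeSpace_time_spatial]

/-- The time coordinate of `x + t e₀` is `x⁰ + t`. [folklore] -/
theorem time_add_smul_basisVector_zero (x : E4) (t : ℝ) :
    E4.time (x + t • E4.basisVector 0) = E4.time x + t := by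
  simp [E4.time_apply]

/-- The time coordinate of `t e₀` is `t`. [folklore] -/
theorem time_smul_basisVector_zero (t : ℝ) : E4.time (t • E4.basisVector 0) = t := by
  simp [E4.time_apply]

/-- A point of `E4` is determined by its time and its spatial part. [folklore] -/
theorem E4_ext_time_spatial {u v : E4} (ht : E4.time u = E4.time v) (hs : E4.spatial u = E4.spatial v) :
    u = v := by
  rw [← E4.ofTimeSpace_time_spatial u, ← E4.ofTimeSpace_time_spatial v, ht, hs]

/-- The time axis vector `e₀` is non-zero. [folklore] -/
theorem basisVector_zero_ne_zero : E4.basisVector 0 ≠ 0 := by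
  intro h
  have := congrArg (fun v : E4 ↦ v 0) h
  simp at this

/-- `t ↦ t e₀` is injective. [folklore] -/
theorem smul_basisVector_zero_injective : Function.Injective fun t : ℝ ↦ t • E4.basisVector 0 :=
  smul_left_injective ℝ basisVector_zero_ne_zero

/-! ## §E2 Time-translation invariant sets -/

section Invariant

variable {S : Set E4}

/-- In a time-translation invariant set, the foot `(0, y)` of every point `(t, y)` lies in the
set. [folklore] -/
theorem ofTimeSpace_zero_spatial_mem (hS : ∀ x ∈ S, ∀ s : ℝ, x + s • E4.basisVector 0 ∈ S)
    {x : E4} (hx : x ∈ S) : E4.ofTimeSpace 0 (E4.spatial x) ∈ S := by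
  have h := hS x hx (-E4.time x)
  have e : x + (-E4.time x) • E4.basisVector 0 = E4.ofTimeSpace 0 (E4.spatial x) := by
    rw [neg_smul, ← sub_eq_add_neg, sub_eq_iff_eq_add, ofTimeSpace_zero_spatial_add_time_smul]
  rwa [e] at h

/-- In a time-translation invariant set, `(t, y) ∈ S` as soon as `(0, y) ∈ S`. [folklore] -/
theorem ofTimeSpace_mem_of_zero_mem (hS : ∀ x ∈ S, ∀ s : ℝ, x + s • E4.basisVector 0 ∈ S)
    {y : E3} (hy : E4.ofTimeSpace 0 y ∈ S) (t : ℝ) : E4.ofTimeSpace t y ∈ S := by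
  rw [← E4.ofTimeSpace_zero_add_smul]
  exact hS _ hy t

/-- The Kerr–Schild regions `Kerr.region a r₀ = {r > max r₀ 0}` are time-translation invariant
(the radius does not depend on `t*`; Dafermos–Rodnianski arXiv:0811.0354, §5.1). [folklore] -/
theorem kerrRegion_add_smul_mem (a r₀ : ℝ) :
    ∀ x ∈ (Kerr.region a r₀ : Set E4), ∀ s : ℝ, x + s • E4.basisVector 0 ∈ (Kerr.region a r₀ : Set E4) :=
  fun _ hx s ↦ Kerr.add_smul_basisVector_zero_mem_region hx s

end Invariant

/-! ## §E3 `T`-equivariant maps -/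

section Equivariant

variable {S : Set E4} {Θ : E4 → E4} {c : ℝ}

/-- **Normal form of a `T`-equivariant map**: `Θ (t, y) = Θ (0, y) + (c t) e₀` on a
time-translation invariant set. [folklore] -/
theorem apply_eq_apply_foot_add (hS : ∀ x ∈ S, ∀ s : ℝ, x + s • E4.basisVector 0 ∈ S)
    (hΘ : ∀ x ∈ S, ∀ s : ℝ, Θ (x + s • E4.basisVector 0) = Θ x + (c * s) • E4.basisVector 0)
    {x : E4} (hx : x ∈ S) :
    Θ x = Θ (E4.ofTimeSpace 0 (E4.spatial x)) + (c * E4.time x) • E4.basisVector 0 := by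
  have h := hΘ _ (ofTimeSpace_zero_spatial_mem hS hx) (E4.time x)
  rwa [ofTimeSpace_zero_spatial_add_time_smul] at h

/-- The spatial part of a `T`-equivariant map does not depend on time:
`(Θ (t, y))_{space} = (Θ (0, y))_{space}`. [folklore] -/
theorem spatial_apply_eq (hS : ∀ x ∈ S, ∀ s : ℝ, x + s • E4.basisVector 0 ∈ S)
    (hΘ : ∀ x ∈ S, ∀ s : ℝ, Θ (x + s • E4.basisVector 0) = Θ x + (c * s) • E4.basisVector 0)
    {x : E4} (hx : x ∈ S) :
    E4.spatial (Θ x) = E4.spatial (Θ (E4.ofTimeSpace 0 (E4.spatial x))) := by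
  rw [apply_eq_apply_foot_add hS hΘ hx, map_add, map_smul, E4.spatial_basisVector_zero, smul_zero,
    add_zero]

/-- The time part of a `T`-equivariant map is `(Θ (0, y))⁰ + c t`. [folklore] -/
theorem time_apply_eq (hS : ∀ x ∈ S, ∀ s : ℝ, x + s • E4.basisVector 0 ∈ S)
    (hΘ : ∀ x ∈ S, ∀ s : ℝ, Θ (x + s • E4.basisVector 0) = Θ x + (c * s) • E4.basisVector 0)
    {x : E4} (hx : x ∈ S) :
    E4.time (Θ x) = E4.time (Θ (E4.ofTimeSpace 0 (E4.spatial x))) + c * E4.time x := by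
  rw [apply_eq_apply_foot_add hS hΘ hx, time_add_smul_basisVector_zero]

/-- The image of a time-translation invariant set under a `T`-equivariant map with `c ≠ 0` is
time-translation invariant. [folklore] -/
theorem add_smul_mem_image (hc : c ≠ 0)
    (hS : ∀ x ∈ S, ∀ s : ℝ, x + s • E4.basisVector 0 ∈ S)
    (hΘ : ∀ x ∈ S, ∀ s : ℝ, Θ (x + s • E4.basisVector 0) = Θ x + (c * s) • E4.basisVector 0)
    {u : E4} (hu : u ∈ Θ '' S) (s : ℝ) : u + s • E4.basisVector 0 ∈ Θ '' S := by
  obtain ⟨x, hx, rfl⟩ := hu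
  refine ⟨x + (s / c) • E4.basisVector 0, hS x hx _, ?_⟩
  rw [hΘ x hx, mul_div_cancel₀ s hc]

/-- **Injectivity criterion.** A `T`-equivariant map with `c ≠ 0` on a time-translation invariant
set `S` is injective on `S` iff its SPATIAL part restricted to the slice `{y | (0, y) ∈ S}` is
injective: two points with the same spatial image are time translates of points with the same
image. [folklore] -/
theorem injOn_iff_injOn_spatial (hc : c ≠ 0)
    (hS : ∀ x ∈ S, ∀ s : ℝ, x + s • E4.basisVector 0 ∈ S)
    (hΘ : ∀ x ∈ S, ∀ s : ℝ, Θ (x + s • E4.basisVector 0) = Θ x + (c * s) • E4.basisVector 0) :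
    InjOn Θ S ↔
      InjOn (fun y : E3 ↦ E4.spatial (Θ (E4.ofTimeSpace 0 y))) {y : E3 | E4.ofTimeSpace 0 y ∈ S} := by
  constructor
  · intro hinj y hy y' hy' hyy'
    simp only [mem_setOf_eq] at hy hy'
    simp only at hyy'
    -- match the time parts by a time translation of `(0, y)`
    set τ : ℝ := E4.time (Θ (E4.ofTimeSpace 0 y)) with hτ
    set τ' : ℝ := E4.time (Θ (E4.ofTimeSpace 0 y')) with hτ'
    have hp : E4.ofTimeSpace 0 y + ((τ' - τ) / c) • E4.basisVector 0 ∈ S := hS _ hy _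
    have hΘp : Θ (E4.ofTimeSpace 0 y + ((τ' - τ) / c) • E4.basisVector 0) = Θ (E4.ofTimeSpace 0 y') := by
      rw [hΘ _ hy, mul_div_cancel₀ _ hc]
      refine E4_ext_time_spatial ?_ ?_
      · rw [time_add_smul_basisVector_zero, ← hτ, ← hτ']
        ring
      · rw [map_add, map_smul, E4.spatial_basisVector_zero, smul_zero, add_zero, hyy']
    have h := hinj hp hy' hΘp
    have h' := congrArg E4.spatial h
    rwa [Kerr.spatial_add_smul_basisVector_zero, E4.spatial_ofTimeSpace, E4.spatial_ofTimeSpace] at h'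
  · intro hinj x hx x' hx' hxx'
    have ex := apply_eq_apply_foot_add hS hΘ hx
    have ex' := apply_eq_apply_foot_add hS hΘ hx'
    -- spatial parts agree, hence the feet agree
    have hsp : E4.spatial x = E4.spatial x' := by
      refine hinj (ofTimeSpace_zero_spatial_mem hS hx) (ofTimeSpace_zero_spatial_mem hS hx') ?_
      simp only
      rw [← spatial_apply_eq hS hΘ hx, ← spatial_apply_eq hS hΘ hx', hxx']
    -- time parts agree since `c ≠ 0`
    have htm : E4.time x = E4.time x' := by
      have h1 := time_apply_eq hS hΘ hx
      have h2 := time_apply_eq hS hΘ hx'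
      rw [hxx', hsp] at h1
      have : c * E4.time x = c * E4.time x' := by linarith
      exact mul_left_cancel₀ hc this
    exact E4_ext_time_spatial htm hsp

/-- **The differential of a `T`-equivariant map on the time axis**: `dΘ_x (e₀) = c e₀` wherever
`Θ` is differentiable (differentiate `s ↦ Θ (x + s e₀) = Θ x + (c s) e₀` at `s = 0`). With an
adapted chart `A` (`dA (e₀) = T`) this is `d(A ∘ Θ)(∂_{t*}) = c T`. [folklore] -/
theorem fderiv_apply_basisVector_zero {x : E4}
    (hΘ : ∀ s : ℝ, Θ (x + s • E4.basisVector 0) = Θ x + (c * s) • E4.basisVector 0)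
    (hd : DifferentiableAt ℝ Θ x) :
    fderiv ℝ Θ x (E4.basisVector 0) = c • E4.basisVector 0 := by
  -- the line `s ↦ x + s e₀` and its image `s ↦ Θ x + (c s) e₀`
  have hγ : HasDerivAt (fun s : ℝ ↦ x + s • E4.basisVector 0) ((1 : ℝ) • E4.basisVector 0) 0 :=
    ((hasDerivAt_id (0 : ℝ)).smul_const (E4.basisVector 0)).const_add x
  have h1 : HasDerivAt (fun s : ℝ ↦ Θ (x + s • E4.basisVector 0))
      (fderiv ℝ Θ x ((1 : ℝ) • E4.basisVector 0)) 0 :=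
    HasFDerivAt.comp_hasDerivAt_of_eq 0 hd.hasFDerivAt hγ (by simp)
  have h2 : HasDerivAt (fun s : ℝ ↦ Θ x + (c * s) • E4.basisVector 0) ((c * 1) • E4.basisVector 0) 0 :=
    (((hasDerivAt_id (0 : ℝ)).const_mul c).smul_const (E4.basisVector 0)).const_add (Θ x)
  have h3 : (fun s : ℝ ↦ Θ (x + s • E4.basisVector 0)) = fun s : ℝ ↦ Θ x + (c * s) • E4.basisVector 0 :=
    funext hΘ
  rw [h3] at h1
  have h := h1.unique h2
  rw [one_smul, mul_one] at h
  exact h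

/-- On an OPEN time-translation invariant set on which `Θ` is `C¹`, `dΘ (e₀) = c e₀` at every
point (`fderiv_apply_basisVector_zero` with differentiability from `ContDiffOn`). [folklore] -/
theorem fderiv_apply_basisVector_zero_of_contDiffOn (hSo : IsOpen S) {n : WithTop ℕ∞} (hn : n ≠ 0)
    (hΘs : ContDiffOn ℝ n Θ S)
    (hΘ : ∀ x ∈ S, ∀ s : ℝ, Θ (x + s • E4.basisVector 0) = Θ x + (c * s) • E4.basisVector 0)
    {x : E4} (hx : x ∈ S) :
    fderiv ℝ Θ x (E4.basisVector 0) = c • E4.basisVector 0 :=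
  fderiv_apply_basisVector_zero (hΘ x hx) ((hΘs.differentiableOn hn).differentiableAt (hSo.mem_nhds hx))

end Equivariant

/-! ## §E4 Registered helper (binder-free form) -/

/-- **Registered helper `timeEquivariant_injOn_iff`** (binder-free form of `injOn_iff_injOn_spatial`):
a `T`-equivariant map `Θ (x + s e₀) = Θ x + (c s) e₀`, `c ≠ 0`, of a time-translation invariant set
`S ⊆ E4` is injective on `S` iff the spatial part of its restriction to the slice `{y | (0, y) ∈ S}` is
injective. [folklore] -/
theorem timeEquivariant_injOn_iff : ∀ (S : Set E4) (Θ : E4 → E4) (c : ℝ), c ≠ 0 →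
    (∀ x ∈ S, ∀ s : ℝ, x + s • E4.basisVector 0 ∈ S) →
    (∀ x ∈ S, ∀ s : ℝ, Θ (x + s • E4.basisVector 0) = Θ x + (c * s) • E4.basisVector 0) →
    (Set.InjOn Θ S ↔
      Set.InjOn (fun y : E3 ↦ E4.spatial (Θ (E4.ofTimeSpace 0 y))) {y : E3 | E4.ofTimeSpace 0 y ∈ S}) :=
  fun _ _ _ hc hS hΘ ↦ injOn_iff_injOn_spatial hc hS hΘ

end Summit.FinalStateConjecture.FinalStateConjecture.Theorems.SymplecticDualOfTheBomb

end
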